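import Summits.BirchSwinnertonDyer.BirchSwinnertonDyer.Theorems.SchneiderFreeAdditiveX3PoitouTateAllPlacesReduction
import Literature.Algebra.Homology.ExtPresentationBoundary
import Literature.Algebra.Homology.ExtDualityPairing
import Literature.NumberTheory.GaloisRepresentations.GalLayerSystemSES
import Literature.NumberTheory.GaloisRepresentations.IdeleClassBarInvariant
import HarnessLib

/-!
# Poitou–Tate toolkit: the ALL-PLACES middle exactness `Ker γ¹ ⊆ Im β¹` (hypothesis `hA` of
# `poitouTate_selmerStructure_duality_of_allPlaces_canonical`) from a PRESENTATION of `M^D` in `C_Γ`,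
# Tate's `α¹`-injectivity for `C̄`, and a READOUT of equivariant homomorphisms into `J̄`

Cell `bsd-schneider-ideate`, seat `bsd-schneider-door-c6` (prover, generation 16).  PARTITION: board row
B6 ∩ X3 ∩ sst-twist, `r = 1`, of `Rank1Residual.partition` — CONTROL corner (crux `AnticycControlAdditiveK`,
stmt-BirchSwinnertonDyer-19295; facts binder `ControlFacts` (i), stmt-19538); types-the-object-of the LAST
ASSEMBLY STEP of the "presentation / layer road" to the single remaining input `hE` (Milne *ADT* I Thm. 4.10(b),
`r = 1`, inclusion `Ker γ¹ ⊆ Im β¹`, for THE invariant maps): it isolates, as explicit hypotheses on existing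
objects, exactly what the remaining files of the road must supply.  THEOREMS ONLY; closes nothing by itself
(BSD is not advanced; no case of Poitou–Tate is proved here).

THE ARGUMENT (Milne, *ADT* I, proof of Thm. 4.10, p. 58, run at the level of HOMOMORPHISMS).  Fix a number
field `K`, `n ≥ 1`, a finite discrete `Γ_K`-module `ρ` on `M`, and in door-c4's category
`C_Γ = DiscreteRepCat ℤ Γ_K`:
* a short exact `S : 0 → N₁ → P → N → 0` (intended: door-c4's free presentation of `N = M^D`,
  `DiscreteRep.freePresentation_shortExact`, `P = FreePresentation.presLattice E₀ m`) with
  `hP : Ext¹_{C_Γ}(P, F̄ˣ) = 0` (door-c6 g16 `FreePresentation.ext_presLattice_unitsBarD_eq_zero`);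
* door-c5's `T : 0 → F̄ˣ → J̄ → C̄ → 0` (`ideleClassLimitShortComplex K`, `…_shortExact`);
* Tate's injectivity of `α¹(Γ_K, N) : Ext¹_{C_Γ}(N, C̄) → Hom(Ext¹(ℤ, N), ℚ/ℤ)` for `inv = classBarInv K`
  (`hα`; door-c4's `adjointMap_one_injective` / door-c6 g15's `adjointMap_one_injective_classBarD` once the two
  `TateDualityHypotheses` fields of door-c4 g16 land);
* a READOUT `R_v : Hom_{C_Γ}(N₁, J̄) →+ H¹(K_v, M)` at every place `v` with four properties:
  (R1) `R_v (ι ≫ q) = 0` for `q : P → J̄` (intended: exactness of the `Hom`-dual sequence, door-c6 g16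
  `HomDual.dualδ₀_precomp_eq_zero`); (R2) `R_v (h ≫ (F̄ˣ → J̄)) = loc_v x_h` for a GLOBAL class `x_h ∈ H¹(K, M)`
  (naturality of the native `δ₀` under `res`); (R3) SURJECTIVITY onto the restricted product: every
  `t ∈ P¹(K, M)` supported on an admissible `T` is `(R_v f)_v` for one `f : N₁ → J̄` (Milne Lemma 4.13, local
  part = door-c6 g16 `HomDual.dualδ₀_surjective` + `HomPermutation.galoisCohomology_hom_units_eq_zero`,
  assembly = "`Hom_G(N₁, J_E) = ∏'_v Hom_{D_w}(N₁, E_wˣ)`"); (R4) PAIRING: `inv_K(ŷ ∘ ∂(f ≫ (J̄ → C̄)))`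
  vanishes as soon as the local Tate pairings `∑_v inv_v(R_v f ∪ loc_v y)` of `R f` against (a native
  representative `y` of) `ŷ` vanish (the finite-layer computation `inv_K(Inf y₀ ∘ [S] ∘ (g f)) =
  inv_{E/K}((g f₀)_* δ y₀) = Σ_v inv_v((h_v)_* res δ y₀) = −Σ_v inv_v(δ₀ h_v ∪ y_v)`).
THEN `hA` holds for `(n, ρ)`: given `t`, take `f` from (R3); for every `ŷ ∈ Ext¹(ℤ, N)` the hypothesis of `hA`
(orthogonality to every `y ∈ H¹(K, M^D)`) and (R4) give `inv_K(ŷ ∘ ∂(f ≫ g)) = 0`, so `α¹(∂(f ≫ g)) = 0`, so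
`∂(f ≫ g) = 0` (`hα`); by door-c6 g16's CHASE (`ExtPresentation.exists_eq_add_of_boundary_comp_eq_zero`, which
consumes `hP`) `f = h ≫ (F̄ˣ → J̄) + ι ≫ q`, hence `t_v = R_v f = loc_v x_h + 0` at every place.

* `adjointMap_boundary_eq_zero` — (R4)-type vanishing for all `ŷ` ⟹ `α¹(∂ u) = 0`;
* **`middleExact_allPlaces_of_readout`** — the statement above (its conclusion is VERBATIM the body of the
  hypothesis `hA` of `poitouTate_selmerStructure_duality_of_allPlaces_canonical` at `(n, ρ)`).

References: [MilneADT2006] I Lemma 4.13, Thm. 4.10 (b) and its proof (p. 58); [Harari2020] §16.3, §17.3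
(Thm. 17.13); [Weibel1994] §2.7.
-/

noncomputable section

open Function NumberField IsDedekindDomain CategoryTheory CategoryTheory.Abelian
open scoped NumberField

set_option linter.dupNamespace false
set_option autoImplicit false

namespace Summit.BirchSwinnertonDyer.BirchSwinnertonDyer.Theorems.SchneiderFreeAdditiveX3.PoitouTateReduction

open Field
open Literature.NumberTheory.GaloisRepresentations Literature.NumberTheory.GaloisCohomology
open Literature.NumberTheory.GaloisRepresentations.DiscreteGaloisModule (mu TateDual tateDual
  localTatePairingZMod unramifiedSubgroup)
open Literature.Algebra.Homology Literature.Algebra.Homology.DiscreteRep Literature.Algebra.Homology.ExtPresentation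
open Literature.NumberTheory.GaloisRepresentations.IdeleClassBar (classBarInv classBarD)

section Readout

variable {K : Type} [Field K] [NumberField K] {n : ℕ} [NeZero n]
variable {M : Type} [AddCommGroup M] [TopologicalSpace M] [DiscreteTopology M] [Finite M]

/-- **`α¹(∂ u) = 0` from the vanishing of all pairings**: if `inv (ŷ ∘ ∂u) = 0` for every
`ŷ ∈ Ext¹(ℤ, N)`, then the adjoint `α¹(N)(∂ u) : Ext¹(ℤ, N) → ℚ/ℤ` is zero.
[cite: Harari2020, §16.3][cite: MilneADT2006, Ch. I, Thm. 4.10 (proof)] -/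
theorem adjointMap_eq_zero_of_forall {S : ShortComplex (DiscreteRepCat ℤ (absoluteGaloisGroup K))}
    (x : Abelian.Ext S.X₃ (classBarD K) 1)
    (h : ∀ ŷ : Abelian.Ext (triv (Γ := absoluteGaloisGroup K) ℤ) S.X₃ 1,
      classBarInv K (ŷ.comp x (rfl : 1 + 1 = 2)) = 0) :
    ExtDuality.adjointMap (P := triv (Γ := absoluteGaloisGroup K) ℤ) (classBarInv K) S.X₃
      (rfl : 1 + 1 = 2) x = 0 := by
  ext ŷ
  rw [ExtDuality.pairing_apply, AddMonoidHom.zero_apply]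
  exact h ŷ

/-- **Milne I Thm. 4.10(b), `r = 1`, `Ker γ¹ ⊆ Im β¹` over ALL places, from a presentation of `M^D`, Tate's
`α¹`-injectivity for `C̄`, and a readout of `Hom_{C_Γ}(N₁, J̄)` with properties (R1)–(R4).**  The conclusion is,
verbatim, the body of the hypothesis `hA` of `poitouTate_selmerStructure_duality_of_allPlaces_canonical` at
`(n, ρ)`.  See the module docstring for the intended discharges of the hypotheses.
[cite: MilneADT2006, Ch. I, Lemma 4.13 and Thm. 4.10(b) (proof, p. 58)][cite: Harari2020, §17.3, Thm. 17.13] -/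
theorem middleExact_allPlaces_of_readout (ρ : DiscreteGaloisModule K M)
    {S : ShortComplex (DiscreteRepCat ℤ (absoluteGaloisGroup K))} (hS : S.ShortExact)
    (hP : ∀ x : Abelian.Ext S.X₂ (ideleClassLimitShortComplex K).X₁ 1, x = 0)
    (hα : ExtDuality.AdjointInjective (P := triv (Γ := absoluteGaloisGroup K) ℤ) (classBarInv K) S.X₃
      (rfl : 1 + 1 = 2))
    (R : ∀ v : Place K, (S.X₁ ⟶ (ideleClassLimitShortComplex K).X₂) →+ galoisCohomology (ρ.toLocal v) 1)
    (hR1 : ∀ (q : S.X₂ ⟶ (ideleClassLimitShortComplex K).X₂) (v : Place K), R v (S.f ≫ q) = 0)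
    (hR2 : ∀ h : S.X₁ ⟶ (ideleClassLimitShortComplex K).X₁, ∃ x : galoisCohomology ρ 1,
      ∀ v : Place K, R v (h ≫ (ideleClassLimitShortComplex K).f) = galoisCohomology.localization ρ v 1 x)
    (hR3 : ∀ T : Finset (Place K), (∀ w : InfinitePlace K, (Sum.inl w : Place K) ∈ T) →
      (∀ v : HeightOneSpectrum (𝓞 K), (Sum.inr v : Place K) ∉ T →
        ((n : ℕ) : 𝓞 K) ∉ v.asIdeal ∧ GaloisRep.IsUnramifiedAt v ρ) →
      ∀ t : Π v : Place K, galoisCohomology (ρ.toLocal v) 1,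
        (∀ v : HeightOneSpectrum (𝓞 K), (Sum.inr v : Place K) ∉ T →
          t (Sum.inr v) ∈ unramifiedSubgroup (GaloisRep.toLocal v ρ) 1) →
        ∃ f : S.X₁ ⟶ (ideleClassLimitShortComplex K).X₂, ∀ v : Place K, R v f = t v)
    (hR4 : ∀ (f : S.X₁ ⟶ (ideleClassLimitShortComplex K).X₂)
      (ŷ : Abelian.Ext (triv (Γ := absoluteGaloisGroup K) ℤ) S.X₃ 1) (T₀ : Finset (Place K)),
      ∃ (y : galoisCohomology (ρ.tateDual n) 1) (Ty : Finset (Place K)), T₀ ⊆ Ty ∧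
        (∀ v : HeightOneSpectrum (𝓞 K), (Sum.inr v : Place K) ∉ Ty →
          galoisCohomology.localization (ρ.tateDual n) (Sum.inr v) 1 y ∈
            unramifiedSubgroup (GaloisRep.toLocal v (ρ.tateDual n)) 1) ∧
        ((∀ T' : Finset (Place K), Ty ⊆ T' →
            ∑ v ∈ T', localTatePairingZMod ρ n v (LocalInvariants.canonical K n v) (R v f)
              (galoisCohomology.localization (ρ.tateDual n) v 1 y) = 0) →
          classBarInv K (ŷ.comp (boundary hS (classBarD K) (f ≫ (ideleClassLimitShortComplex K).g))
            (rfl : 1 + 1 = 2)) = 0)) :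
    ∀ T : Finset (Place K), (∀ w : InfinitePlace K, (Sum.inl w : Place K) ∈ T) →
      (∀ v : HeightOneSpectrum (𝓞 K), (Sum.inr v : Place K) ∉ T →
        ((n : ℕ) : 𝓞 K) ∉ v.asIdeal ∧ GaloisRep.IsUnramifiedAt v ρ) →
      ∀ t : Π v : Place K, galoisCohomology (ρ.toLocal v) 1,
        (∀ v : HeightOneSpectrum (𝓞 K), (Sum.inr v : Place K) ∉ T →
          t (Sum.inr v) ∈ unramifiedSubgroup (GaloisRep.toLocal v ρ) 1) →
        (∀ (y : galoisCohomology (ρ.tateDual n) 1) (T' : Finset (Place K)), T ⊆ T' →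
          (∀ v : HeightOneSpectrum (𝓞 K), (Sum.inr v : Place K) ∉ T' →
            galoisCohomology.localization (ρ.tateDual n) (Sum.inr v) 1 y ∈
              unramifiedSubgroup (GaloisRep.toLocal v (ρ.tateDual n)) 1) →
          ∑ v ∈ T', localTatePairingZMod ρ n v (LocalInvariants.canonical K n v) (t v)
            (galoisCohomology.localization (ρ.tateDual n) v 1 y) = 0) →
        ∃ x : galoisCohomology ρ 1, ∀ v : Place K, galoisCohomology.localization ρ v 1 x = t v := by
  intro T hinf hT t ht horth
  -- (R3): one equivariant homomorphism `f : N₁ → J̄` with all the prescribed readouts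
  obtain ⟨f, hf⟩ := hR3 T hinf hT t ht
  -- the class `∂(f ≫ g) ∈ Ext¹(N, C̄)` pairs to zero with every `ŷ ∈ Ext¹(ℤ, N)` (R4 + orthogonality)
  have hpair : ∀ ŷ : Abelian.Ext (triv (Γ := absoluteGaloisGroup K) ℤ) S.X₃ 1,
      classBarInv K (ŷ.comp (boundary hS (classBarD K) (f ≫ (ideleClassLimitShortComplex K).g))
        (rfl : 1 + 1 = 2)) = 0 := by
    intro ŷ
    obtain ⟨y, Ty, hTTy, hyur, himp⟩ := hR4 f ŷ T
    refine himp fun T' hT' => ?_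
    have h := horth y T' (hTTy.trans hT') fun v hv => hyur v fun hv' => hv (hT' hv')
    simpa only [hf] using h
  -- `α¹` is injective, so `∂(f ≫ g) = 0`
  have h0 : boundary hS (classBarD K) (f ≫ (ideleClassLimitShortComplex K).g) = 0 :=
    hα ((adjointMap_eq_zero_of_forall _ hpair).trans (map_zero _).symm)
  -- the chase: `f = h ≫ (F̄ˣ → J̄) + ι ≫ q`
  obtain ⟨h, q, hfq⟩ := exists_eq_add_of_boundary_comp_eq_zero hS
    (ideleClassLimitShortComplex_shortExact K) hP f h0
  -- readouts: `t_v = R_v f = loc_v x_h + 0`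
  obtain ⟨x, hx⟩ := hR2 h
  refine ⟨x, fun v => ?_⟩
  rw [← hf v, hfq, map_add, hR1, add_zero, hx]

end Readout

end Summit.BirchSwinnertonDyer.BirchSwinnertonDyer.Theorems.SchneiderFreeAdditiveX3.PoitouTateReduction

end
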